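import Mathlib
import HarnessLib
import Literature.NumberTheory.EllipticCurves.FramedTateGaloisRep
import Literature.NumberTheory.EllipticCurves.TateModuleFixedPointsProofs
import Literature.NumberTheory.GaloisRepresentations.LocalGaloisGroup
import Literature.NumberTheory.Automorphic.AdicCompletionLocalField

/-!
# Stub `stub_cousinGaloisPackage` (line `descend-raise-basechange`, crux stmt-Langlands-12920, v4 cousin
# graft) — auxiliary file II: the ORIENTED ordinary frame at `v ∣ p` from the ordinary line of `V_p E`

Helper lemmas (all proved, no new definition) for the Galois side S7a of the cousin graft of the line
`descend-raise-basechange` of `Summit.Langlands.Langlands.Theses.SkinnerWilesDefectOne.EisensteinProModularSeed`: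

* `conj_entries_of_eigen` — `2 × 2` linear algebra over a field: if `(α, β)ᵀ` (`β ≠ 0`) is an eigenvector
  of `A` with eigenvalue `λ`, then in the frame `Q = (α 1; β 0)` the matrix `Q⁻¹ A Q` is upper
  triangular with diagonal `(λ, tr A - λ)`;
* `tensorBasis_apply`, `smul_toRational`, `rationalGaloisRepTate_toRational`,
  `toZModPow_one_eq_zero_of_norm_lt_one` — bookkeeping between `T_p E` and `V_p E = ℚ_p ⊗ T_p E`;
* `ramificationIdx_le_finrank_rat` — `e(v ∣ p) ≤ [F : ℚ]` (Mathlib's fundamental identity);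
* `exists_oriented_frame` — **the orientation argument.**  Let `(a, b)` be a `ℤ_p`-basis of `T_p E`
  whose level-`1` map is injective (so `(a₁, b₁)` is a basis of `E[p]`), `v` a finite place, `𝔓 ∣ v` a
  prime of `\bar ℤ_F` whose inertia group receives the local inertia group `I_{F_v}` and fixes `a₁`, and
  suppose some `σ ∈ I_{F_v}` has `χ_p(σ) ≢ 1 (mod p)`.  If `L ⊂ V_p E` is a `Γ_{F_v}`-stable `ℚ_p`-line on
  which `I_{F_v}` acts through `χ_p` and such that `I_{F_v}` acts trivially on `V_p E / L` (the ORDINARY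
  line), then for `V_p E` framed in `1 ⊗ (a, b)` there is an ORIENTED frame `Q` (`‖Q₀₀‖ ≤ ‖Q₁₀‖`) with
  `Q⁻¹ r|_{Γ_{F_v}} Q` upper triangular, lower-right entry `1` and upper-left entry `χ_p` on inertia —
  the crux's local clause with `(k, m) = (2, 1)`.  Indeed a generator `w = α (1 ⊗ a) + β (1 ⊗ b)` of `L`
  has `‖α‖ ≤ ‖β‖`: otherwise `w/α = 1 ⊗ (a + γ b)` with `‖γ‖ < 1` reduces to `a₁ ∈ E[p]`, which is
  fixed by inertia while inertia acts on `w` through `χ_p` (injectivity of `T_p E → V_p E` and of the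
  level-`1` map), forcing `χ_p ≡ 1 (mod p)` on `I_{F_v}`; and then `Q = (α 1; β 0)` works
  (`conj_entries_of_eigen`, the quotient character being `1` on inertia).

References: J.-P. Serre, *Propriétés galoisiennes des points d'ordre fini des courbes elliptiques*,
Invent. Math. 15 (1972), §1.11; R. Greenberg, *Iwasawa theory for motives* (1991), §2;
C. M. Skinner, A. J. Wiles, Publ. Math. IHÉS 89 (1999), §1 and Thm. A (the orientation). [folklore]
-/

set_option linter.dupNamespace false -- project-wide option (lakefile weak.linter.dupNamespace); `Summit.Langlands.Langlands` is the mandated namespace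

noncomputable section

namespace Summit.Langlands.Langlands.Theorems.SkinnerWilesDefectOne.EisensteinProModularSeed.Cousin

open Literature.NumberTheory.EllipticCurves Literature.NumberTheory.GaloisRepresentations
open Field IsDedekindDomain
open scoped NumberField MatrixGroups Matrix TensorProduct

/-! ### `2 × 2` linear algebra: the frame `(w, e₀)` of an eigenvector `w` -/

/-- If `(α, β)ᵀ` with `β ≠ 0` is an eigenvector of the `2 × 2` matrix `A` for the eigenvalue `λ`, then
for `Q = (α 1; β 0)` the conjugate `Q⁻¹ A Q` has entries `(Q⁻¹AQ)₁₀ = 0`, `(Q⁻¹AQ)₀₀ = λ` and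
`(Q⁻¹AQ)₁₁ = A₀₀ + A₁₁ - λ` (`A Q = Q B` for the displayed upper-triangular `B`). [folklore] -/
theorem conj_entries_of_eigen {K : Type*} [Field K] (A : Matrix (Fin 2) (Fin 2) K) {α β lam : K}
    (hβ : β ≠ 0) (e0 : A 0 0 * α + A 0 1 * β = lam * α) (e1 : A 1 0 * α + A 1 1 * β = lam * β) :
    ((!![α, 1; β, 0])⁻¹ * A * !![α, 1; β, 0]) 1 0 = 0 ∧
      ((!![α, 1; β, 0])⁻¹ * A * !![α, 1; β, 0]) 0 0 = lam ∧
      ((!![α, 1; β, 0])⁻¹ * A * !![α, 1; β, 0]) 1 1 = A 0 0 + A 1 1 - lam := by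
  set Qm : Matrix (Fin 2) (Fin 2) K := !![α, 1; β, 0] with hQm
  set B : Matrix (Fin 2) (Fin 2) K := !![lam, A 1 0 / β; 0, A 0 0 + A 1 1 - lam] with hB
  have hdet : IsUnit Qm.det := by
    rw [hQm, Matrix.det_fin_two_of]
    exact isUnit_iff_ne_zero.mpr (by simpa using hβ)
  have hAQ : A * Qm = Qm * B := by
    have e1' : A 1 1 = lam - A 1 0 * α / β := by
      field_simp
      linear_combination e1
    ext i j
    fin_cases i <;> fin_cases j
    · simp [hQm, hB, Matrix.mul_apply, Fin.sum_univ_two]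
      linear_combination e0
    · simp [hQm, hB, Matrix.mul_apply, Fin.sum_univ_two]
      rw [e1']
      field_simp
      ring
    · simp [hQm, hB, Matrix.mul_apply, Fin.sum_univ_two]
      linear_combination e1
    · simp [hQm, hB, Matrix.mul_apply, Fin.sum_univ_two]
      field_simp
  have hconj : Qm⁻¹ * A * Qm = B := by
    rw [Matrix.mul_assoc, hAQ, Matrix.nonsing_inv_mul_cancel_left _ _ hdet]
  rw [hconj, hB]
  simp

/-! ### Bookkeeping between `T_p E` and `V_p E` -/

section Tensor

variable {F : Type} [Field F] (p : ℕ) [hp : Fact p.Prime] (W : WeierstrassCurve F)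

/-- `‖z‖ < 1` in `ℤ_p` means `z ≡ 0 (mod p)`. [folklore] -/
theorem toZModPow_one_eq_zero_of_norm_lt_one {z : ℤ_[p]} (h : ‖z‖ < 1) :
    PadicInt.toZModPow 1 z = 0 := by
  rw [← RingHom.mem_ker, PadicInt.ker_toZModPow, pow_one, Ideal.mem_span_singleton]
  exact (PadicInt.norm_lt_one_iff_dvd z).mp h

/-- The vectors of the `ℚ_p`-basis `1 ⊗ bT` of `V_p E` are the images `1 ⊗ bT i` of the `ℤ_p`-basis
vectors of `T_p E` (Mathlib `Algebra.TensorProduct.basis_apply`). [folklore] -/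
theorem tensorBasis_apply (bT : Module.Basis (Fin 2) ℤ_[p] (W.tateModule p)) (i : Fin 2) :
    ((Algebra.TensorProduct.basis ℚ_[p] bT : Module.Basis (Fin 2) ℚ_[p] (W.rationalTateModule p)) i :
      W.rationalTateModule p) = TateModule.toRational p (bT i) :=
  Algebra.TensorProduct.basis_apply bT i

/-- `z · (1 ⊗ t) = 1 ⊗ (z t)` for `z ∈ ℤ_p`. [folklore] -/
theorem smul_toRational (z : ℤ_[p]) (t : W.tateModule p) :
    ((z : ℚ_[p]) • TateModule.toRational p t : W.rationalTateModule p) =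
      TateModule.toRational p (z • t) := by
  rw [LinearMap.map_smul, ← IsScalarTower.algebraMap_smul ℚ_[p] z (TateModule.toRational p t)]
  rfl

/-- The Galois action on `V_p E` extends that on `T_p E`: `σ (1 ⊗ t) = 1 ⊗ σ t`. [folklore] -/
theorem rationalGaloisRepTate_toRational (g : absoluteGaloisGroup F) (t : W.tateModule p) :
    W.rationalGaloisRepTate p g (TateModule.toRational p t) = TateModule.toRational p (g • t) := rfl

end Tensor

/-! ### The ramification bound `e(v ∣ p) ≤ [F : ℚ]` -/

/-- `e(v ∣ p) ≤ [F : ℚ]` for a finite place `v ∣ p` of a number field `F` (Mathlib's fundamental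
identity `∑ eᵢ fᵢ = [F : ℚ]`, `Ideal.ramificationIdx_le_finrank`). Neukirch, *ANT*, Ch. I (8.2). [folklore] -/
theorem ramificationIdx_le_finrank_rat {F : Type} [Field F] [NumberField F]
    (v : HeightOneSpectrum (𝓞 F)) {p : ℕ} (hp : p.Prime) (hpv : (p : 𝓞 F) ∈ v.asIdeal) :
    v.asIdeal.ramificationIdx ℤ ≤ Module.finrank ℚ F := by
  have hmem : (p : ℤ) ∈ v.asIdeal.under ℤ := by
    rw [Ideal.under_def, Ideal.mem_comap, map_natCast]
    exact hpv
  have hne : v.asIdeal.under ℤ ≠ ⊥ := by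
    intro h
    rw [h, Ideal.mem_bot, Nat.cast_eq_zero] at hmem
    exact hp.ne_zero hmem
  haveI : v.asIdeal.IsMaximal := v.isMaximal
  haveI : (v.asIdeal.under ℤ).IsMaximal := Ideal.IsMaximal.under ℤ v.asIdeal
  rw [← Ideal.ramificationIdx'_eq_ramificationIdx (v.asIdeal.under ℤ) v.asIdeal hne]
  exact Ideal.ramificationIdx_le_finrank (R := ℤ) (S := 𝓞 F) ℚ F v.asIdeal

/-! ### The oriented ordinary frame at `v ∣ p` -/

section Local

variable {F : Type} [Field F] [NumberField F] (p : ℕ) [hp : Fact p.Prime]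
  (W : WeierstrassCurve F) [W.IsElliptic]

/-- **The ORIENTED ordinary frame of `V_p E` at `v ∣ p` from the ordinary line.**  See the module
docstring: `(a, b)` a `ℤ_p`-basis `bT` of `T_p E` with injective level-`1` map; `𝔓 ∣ v` receiving the local
inertia group `I_{F_v}` and fixing `a₁ ∈ E[p]`; `χ_p ≢ 1 (mod p)` somewhere on `I_{F_v}`; `L ⊂ V_p E` a
`Γ_{F_v}`-stable `ℚ_p`-line with `I_{F_v}` acting by `χ_p` on `L` and trivially on `V_p E / L`.  Then
`V_p E` framed in `1 ⊗ bT` admits `Q ∈ GL₂(ℚ̄_p)` with `‖Q₀₀‖ ≤ ‖Q₁₀‖`, `(Q⁻¹ r(σ) Q)₁₀ = 0` for all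
`σ ∈ Γ_{F_v}`, and on inertia `(Q⁻¹ r(σ) Q)₁₁ = 1`, `(Q⁻¹ r(σ) Q)₀₀ = χ_p(σ)` (Serre 1972, §1.11: the
kernel of reduction `X_p ⊂ E[p]` carries `χ_p` on inertia, so it is not the inertia-fixed line `⟨a₁⟩`
when `ω|_{I_v} ≠ 1`; Skinner–Wiles' type-𝒟 orientation). [folklore] -/
theorem exists_oriented_frame
    {a b : W.tateModule p} (hinj : Function.Injective (TateModule.levelMap p a b 1))
    (bT : Module.Basis (Fin 2) ℤ_[p] (W.tateModule p)) (h0 : bT 0 = a) (h1 : bT 1 = b)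
    (v : HeightOneSpectrum (𝓞 F))
    {𝔓 : Ideal (absIntegers (𝓞 F) F)}
    (hinto : ∀ σ ∈ absInertia (v.adicCompletion F),
      absGaloisRestrict F (v.adicCompletion F) σ ∈ 𝔓.inertia (absoluteGaloisGroup F))
    (hω : ∃ σ ∈ absInertia (v.adicCompletion F),
      PadicInt.toZModPow 1 ((GaloisRep.cyclotomicCharacter (v.adicCompletion F) p σ : ℤ_[p]ˣ) : ℤ_[p]) ≠ 1)
    (hfix : ∀ σ ∈ 𝔓.inertia (absoluteGaloisGroup F), σ • TateModule.proj p 1 a = TateModule.proj p 1 a)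
    (L : Submodule ℚ_[p] (W.rationalTateModule p)) (hL1 : Module.finrank ℚ_[p] L = 1)
    (hstab : ∀ τ : absoluteGaloisGroup (v.adicCompletion F), ∀ x ∈ L,
      W.rationalGaloisRepTate p (absGaloisRestrict F (v.adicCompletion F) τ) x ∈ L)
    (hchi : ∀ τ ∈ absInertia (v.adicCompletion F), ∀ x ∈ L,
      W.rationalGaloisRepTate p (absGaloisRestrict F (v.adicCompletion F) τ) x =
        (((GaloisRep.cyclotomicCharacter (v.adicCompletion F) p τ : ℤ_[p]ˣ) : ℤ_[p]) : ℚ_[p]) • x)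
    (hquot : ∀ τ ∈ absInertia (v.adicCompletion F), ∀ x : W.rationalTateModule p,
      W.rationalGaloisRepTate p (absGaloisRestrict F (v.adicCompletion F) τ) x - x ∈ L) :
    ∃ Q : Matrix.GeneralLinearGroup (Fin 2) (PadicAlgCl p),
      Valued.v (Q.val 0 0) ≤ Valued.v (Q.val 1 0) ∧
      ∀ σ, (Q⁻¹ * (W.framedTateGaloisRepOfBasis p (W.continuous_rationalGaloisRepTate_holds p)
              (Algebra.TensorProduct.basis ℚ_[p] bT)).toLocal v σ * Q).val 1 0 = 0 ∧
        (σ ∈ absInertia (v.adicCompletion F) →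
          (Q⁻¹ * (W.framedTateGaloisRepOfBasis p (W.continuous_rationalGaloisRepTate_holds p)
              (Algebra.TensorProduct.basis ℚ_[p] bT)).toLocal v σ * Q).val 1 1 ^ 1 = 1 ∧
          (Q⁻¹ * (W.framedTateGaloisRepOfBasis p (W.continuous_rationalGaloisRepTate_holds p)
              (Algebra.TensorProduct.basis ℚ_[p] bT)).toLocal v σ * Q).val 0 0 ^ 1 =
            algebraMap (Padic p) (PadicAlgCl p)
              (((GaloisRep.cyclotomicCharacter (v.adicCompletion F) p σ).val : PadicInt p) :
                Padic p) ^ ((2 - 1) * 1)) := by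
  classical
  set bV : Module.Basis (Fin 2) ℚ_[p] (W.rationalTateModule p) :=
    Algebra.TensorProduct.basis ℚ_[p] bT with hbVdef
  set r := W.framedTateGaloisRepOfBasis p (W.continuous_rationalGaloisRepTate_holds p) bV with hr
  set ρ := W.rationalGaloisRepTate p with hρ
  set res := absGaloisRestrict F (v.adicCompletion F) with hres
  set φ := algebraMap ℚ_[p] (PadicAlgCl p) with hφ
  -- entries of `r`
  have hrA : ∀ (g : absoluteGaloisGroup F) (i j : Fin 2),
      (r g).val i j = φ (LinearMap.toMatrix bV bV (ρ g) i j) := fun g i j => rfl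
  -- a generator of the line
  haveI : Module.Free ℚ_[p] L := Module.Free.of_divisionRing ℚ_[p] L
  obtain ⟨w₁, hw₁0, hw₁⟩ := finrank_eq_one_iff'.mp hL1
  set w₀ : W.rationalTateModule p := (w₁ : W.rationalTateModule p) with hw₀def
  have hw₀0 : w₀ ≠ 0 := fun h => hw₁0 (Subtype.ext h)
  have hw₀L : w₀ ∈ L := w₁.2
  have hline : ∀ y ∈ L, ∃ c : ℚ_[p], c • w₀ = y := fun y hy => by
    obtain ⟨c, hc⟩ := hw₁ ⟨y, hy⟩
    exact ⟨c, by simpa [hw₀def] using congrArg Subtype.val hc⟩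
  set α : ℚ_[p] := bV.repr w₀ 0 with hαdef
  set β : ℚ_[p] := bV.repr w₀ 1 with hβdef
  have hw₀sum : w₀ = α • bV 0 + β • bV 1 := by
    have h := bV.sum_repr w₀
    rw [Fin.sum_univ_two] at h
    exact h.symm
  -- the eigen-equations
  have heig : ∀ (g : absoluteGaloisGroup F) (lam : ℚ_[p]), ρ g w₀ = lam • w₀ →
      LinearMap.toMatrix bV bV (ρ g) 0 0 * α + LinearMap.toMatrix bV bV (ρ g) 0 1 * β = lam * α ∧
      LinearMap.toMatrix bV bV (ρ g) 1 0 * α + LinearMap.toMatrix bV bV (ρ g) 1 1 * β = lam * β := by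
    intro g lam hg
    have h := LinearMap.toMatrix_mulVec_repr bV bV (ρ g) w₀
    rw [hg, map_smul] at h
    have e0 := congrFun h 0
    have e1 := congrFun h 1
    simp only [Matrix.mulVec, dotProduct, Fin.sum_univ_two, Finsupp.coe_smul, Pi.smul_apply,
      smul_eq_mul] at e0 e1
    exact ⟨by rw [← hαdef, ← hβdef] at e0; linear_combination e0,
      by rw [← hαdef, ← hβdef] at e1; linear_combination e1⟩
  -- column `0`
  have hcol : ∀ (g : absoluteGaloisGroup F) (μ : ℚ_[p]), ρ g (bV 0) - bV 0 = μ • w₀ →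
      LinearMap.toMatrix bV bV (ρ g) 0 0 = 1 + μ * α ∧ LinearMap.toMatrix bV bV (ρ g) 1 0 = μ * β := by
    intro g μ hg
    rw [sub_eq_iff_eq_add] at hg
    rw [LinearMap.toMatrix_apply, LinearMap.toMatrix_apply, hg]
    simp [hαdef, hβdef, add_comm]
  by_cases hor : ‖α‖ ≤ ‖β‖
  · -- ORIENTED: the frame `(w₀, e₀)`
    have hβ0 : β ≠ 0 := by
      intro hβ
      apply hw₀0
      have hα : α = 0 := by
        have : ‖α‖ ≤ 0 := by simpa [hβ] using hor
        exact norm_le_zero_iff.mp this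
      rw [hw₀sum, hα, hβ, zero_smul, zero_smul, add_zero]
    have hφβ : φ β ≠ 0 := (map_ne_zero φ).mpr hβ0
    have hdet : Matrix.det !![φ α, 1; φ β, 0] ≠ 0 := by
      rw [Matrix.det_fin_two_of]; simpa using hφβ
    refine ⟨Matrix.GeneralLinearGroup.mkOfDetNeZero _ hdet, ?_, fun σ => ?_⟩
    · change Valued.v (φ α) ≤ Valued.v (φ β)
      rw [PadicAlgCl.valuation_def, PadicAlgCl.valuation_def, ← NNReal.coe_le_coe, coe_nnnorm,
        coe_nnnorm]
      change ‖(α : PadicAlgCl p)‖ ≤ ‖(β : PadicAlgCl p)‖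
      rwa [PadicAlgCl.norm_extends, PadicAlgCl.norm_extends]
    · set g := res σ with hg
      obtain ⟨lam, hlam⟩ := hline _ (hstab σ w₀ hw₀L)
      obtain ⟨e0, e1⟩ := heig g lam hlam.symm
      set A := LinearMap.toMatrix bV bV (ρ g) with hA
      have hX : ((r.toLocal v σ : GL (Fin 2) (PadicAlgCl p)) : Matrix (Fin 2) (Fin 2) (PadicAlgCl p)) =
          A.map φ := by
        ext i j
        rw [FramedGaloisRep.toLocal_apply, Matrix.map_apply]
        exact hrA g i j
      have e0' : A.map φ 0 0 * φ α + A.map φ 0 1 * φ β = φ lam * φ α := by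
        simp only [Matrix.map_apply, ← map_mul, ← map_add, e0]
      have e1' : A.map φ 1 0 * φ α + A.map φ 1 1 * φ β = φ lam * φ β := by
        simp only [Matrix.map_apply, ← map_mul, ← map_add, e1]
      obtain ⟨c10, c00, c11⟩ := conj_entries_of_eigen (A.map φ) hφβ e0' e1'
      have hval : ∀ i j, ((Matrix.GeneralLinearGroup.mkOfDetNeZero _ hdet)⁻¹ * r.toLocal v σ *
          Matrix.GeneralLinearGroup.mkOfDetNeZero _ hdet).val i j =
          ((!![φ α, 1; φ β, 0])⁻¹ * A.map φ * !![φ α, 1; φ β, 0]) i j := by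
        intro i j
        rw [Units.val_mul, Units.val_mul, Matrix.coe_units_inv, hX]
        rfl
      refine ⟨by rw [hval]; exact c10, fun hσ => ?_⟩
      -- on inertia: `lam = χ(σ)` and the quotient is trivial
      set u : ℤ_[p] := ((GaloisRep.cyclotomicCharacter (v.adicCompletion F) p σ : ℤ_[p]ˣ) : ℤ_[p])
        with hu
      have hlamu : lam = (u : ℚ_[p]) := by
        have h := hchi σ hσ w₀ hw₀L
        rw [← hlam] at h
        exact smul_left_injective ℚ_[p] hw₀0 h
      obtain ⟨μ, hμ⟩ := hline _ (hquot σ hσ (bV 0))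
      obtain ⟨f00, f10⟩ := hcol g μ hμ.symm
      have key : A 0 0 + A 1 1 - lam = 1 := by
        have h2 : (A 0 0 + A 1 1 - lam - 1) * β = 0 := by
          linear_combination β * f00 + e1 - α * f10
        exact sub_eq_zero.mp ((mul_eq_zero.mp h2).resolve_right hβ0)
      refine ⟨?_, ?_⟩
      · rw [pow_one, hval, c11]
        simp only [Matrix.map_apply]
        rw [← map_add, ← map_sub, key, map_one]
      · rw [pow_one, hval, c00, hlamu, show (2 - 1) * 1 = 1 from rfl, pow_one]
  · -- ANTI-ORIENTED: contradiction
    exfalso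
    push Not at hor
    have hα0 : α ≠ 0 := by
      intro h
      rw [h, norm_zero] at hor
      exact (not_lt.mpr (norm_nonneg β)) hor
    set γ : ℚ_[p] := β / α with hγ
    have hγn : ‖γ‖ < 1 := by
      rw [hγ, norm_div]
      exact (div_lt_one (norm_pos_iff.mpr hα0)).mpr hor
    set γz : ℤ_[p] := ⟨γ, hγn.le⟩ with hγz
    have hγzn : ‖γz‖ < 1 := hγn
    set t : W.tateModule p := a + γz • b with ht
    set w₂ : W.rationalTateModule p := α⁻¹ • w₀ with hw₂
    have hw₂L : w₂ ∈ L := L.smul_mem _ hw₀L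
    have hb0 : bV 0 = TateModule.toRational p a := by
      rw [hbVdef, ← h0]; exact tensorBasis_apply p W bT 0
    have hb1 : bV 1 = TateModule.toRational p b := by
      rw [hbVdef, ← h1]; exact tensorBasis_apply p W bT 1
    have hw₂t : w₂ = TateModule.toRational p t := by
      rw [hw₂, hw₀sum, smul_add, smul_smul, smul_smul, inv_mul_cancel₀ hα0, one_smul, ht, map_add,
        ← smul_toRational, hb0, hb1]
      congr 1
      show (α⁻¹ * β) • TateModule.toRational p b = (β / α) • TateModule.toRational p b
      rw [div_eq_inv_mul]
    have hprojt : TateModule.proj p 1 t = TateModule.proj p 1 a := by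
      rw [ht, map_add, TateModule.proj_smul, toZModPow_one_eq_zero_of_norm_lt_one p hγzn,
        ZMod.val_zero, zero_smul, add_zero]
    obtain ⟨τ, hτI, hτ⟩ := hω
    set g := res τ with hg
    have hgI := hinto τ hτI
    set u : ℤ_[p] := ((GaloisRep.cyclotomicCharacter (v.adicCompletion F) p τ : ℤ_[p]ˣ) : ℤ_[p])
      with hu
    have hact : g • t = u • t := by
      apply TateModule.toRational_injective (A := W.geomPoints) (p := p)
      rw [← rationalGaloisRepTate_toRational, ← smul_toRational, ← hw₂t]
      exact hchi τ hτI w₂ hw₂L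
    have hP : TateModule.proj p 1 a = (PadicInt.toZModPow 1 u).val • TateModule.proj p 1 a := by
      have h := congrArg (TateModule.proj p 1) hact
      rw [TateModule.proj_smul_of_distribMulAction, TateModule.proj_smul, hprojt, hfix g hgI] at h
      exact h
    have hlev : TateModule.levelMap p a b 1 (((1 : ℤ) : ZMod (p ^ 1)), ((0 : ℤ) : ZMod (p ^ 1))) =
        TateModule.levelMap p a b 1 (PadicInt.toZModPow 1 u, ((0 : ℤ) : ZMod (p ^ 1))) := by
      apply Subtype.ext
      rw [TateModule.coe_levelMap_intCast, TateModule.coe_levelMap, one_zsmul, zero_zsmul, add_zero,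
        Int.cast_zero, ZMod.val_zero, zero_smul, add_zero]
      exact hP
    have h1u : ((1 : ℤ) : ZMod (p ^ 1)) = PadicInt.toZModPow 1 u := congrArg Prod.fst (hinj hlev)
    rw [Int.cast_one] at h1u
    exact hτ h1u.symm

end Local

end Summit.Langlands.Langlands.Theorems.SkinnerWilesDefectOne.EisensteinProModularSeed.Cousin

namespace Summit.Langlands.Langlands.Theorems.SkinnerWilesDefectOne.EisensteinProModularSeed

/-- **Registered sub-goal of `stub_cousinGaloisPackage` (auxiliary file II): the eigenvector frame**
(= `Cousin.conj_entries_of_eigen`, stated with explicit binders): conjugating a `2 × 2` matrix `A` over a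
field by `Q = (α 1; β 0)`, `(α, β)ᵀ` an eigenvector of `A` with `β ≠ 0`, gives an upper-triangular matrix
with diagonal `(λ, tr A - λ)`. [folklore] -/
theorem stub_cousinGaloisPackage_auxFrame :
    ∀ (K : Type) [Field K] (A : Matrix (Fin 2) (Fin 2) K) (α β lam : K), β ≠ 0 → A 0 0 * α + A 0 1 * β = lam * α → A 1 0 * α + A 1 1 * β = lam * β → ((!![α, 1; β, 0])⁻¹ * A * !![α, 1; β, 0]) 1 0 = 0 ∧ ((!![α, 1; β, 0])⁻¹ * A * !![α, 1; β, 0]) 0 0 = lam ∧ ((!![α, 1; β, 0])⁻¹ * A * !![α, 1; β, 0]) 1 1 = A 0 0 + A 1 1 - lam :=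
  fun _ _ A _ _ _ hβ e0 e1 => Cousin.conj_entries_of_eigen A hβ e0 e1

end Summit.Langlands.Langlands.Theorems.SkinnerWilesDefectOne.EisensteinProModularSeed

end
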